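import Literature.MathematicalPhysics.QuantumFieldTheory.Balaban1983to89.Node00.BgAveragingPrOfRecord
import Literature.MathematicalPhysics.QuantumFieldTheory.Balaban1983to89.Node00.LinearisedAveragingInfinitesimalGauge
import Literature.Analysis.Matrix.DetExp
import HarnessLib

/-!
# `Balaban1983to89.Node00.BgHierFrameOfRecord` — [Balaban1985Averaging] (78)–(81) p. 30, (84)–(88) pp. 30–31, (89) p. 31, (92) p. 31;
# [Balaban1985BackgroundPropagators] (3.18)–(3.19) p. 393, (3.113)–(3.115) p. 418: THE RECORD'S HIERARCHICAL FRAME `R^{(k)}(V)` AT THE BACKGROUND `U₀`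
# AS AN INHABITANT OF `FrameDatum` (file A1 of the `(ρ-frame-min)` edition), ITS GERM ALONG GAUGE ORBITS, AND (3.114) `Q^{pr} D_{U₀}λ = L^{-k}·D_{Ū₀}(Q′_k λ)`

Honest framing: statement-level constructions over the tree's letters with citation tags; every `theorem` below is proved (no `sorry`, standard
axioms); nothing here is a claim about the Yang–Mills mass gap.  Cell `pub-ymgap`, seat `pub-ymgap-node00-def-Y` (custodian of the Node00 instance of
record), director-ym ★★★ №608 (A1) ∕ №612 (the Q-37 test: (F1) and (3.114) as NAMED THEOREMS of this file).  Count-neutral: no `KProved` moves, K0ᴬ is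
NOT closed, N06∕N07 are NOT discharged; finite `𝕋⁴` at fixed `ε`; nothing continuum ∕ OS ∕ Clay.

WHAT THIS FILE DOES.  File A2 (`Node00.BgAveragingPrOfRecord`) typed the INTERFACE `FrameDatum P N k U₀` (window, frame, inverse frame, analyticity,
`h(↑U₀) = 1`, the derivative letter) and the framed letters `avPrM`, `qPrCplxOp`, `QprOfRecord`, … over an ARBITRARY datum, with the frameless datum as
vacuity guard.  Here the RECORD'S datum is CONSTRUCTED — print's hierarchical frame:

* §1  the complex (`SL(N, ℂ)`-valued) gauge action through the tree's holomorphic letters `holMh`, `loopMh`, `avgMh`, `iterMh` of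
  `B15AveragingHolomorphic` («`Ū(V^G) = Ū(V)^{G∘emb}`», [Balaban1985Averaging] (11), [Balaban1985Variational] p. 307 «valid for `Gᶜ`-valued fields»;
  the Literature edition of the identities PT-B proved Summits-side in `…C44IterMhGaugeCovariance`, re-proved here because Summits files are not
  importable into Literature);
* §2  the recursion (84)–(87): `Φ₀ = Ψ₀ = 1`,
  `E_{j+1}(V)(y) = L^{-d} Σ_{x ∈ B(y)} log[ Ψ_j(V)(ey) · Ū^j_h(V)(Γ_{y,x}) · Φ_j(V)(x) · Ū^j(U₀)(Γ_{y,x})⋆ ]`,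
  `Φ_{j+1}(V)(y) = Φ_j(V)(ey) · exp E_{j+1}(V)(y)`, `Ψ_{j+1}(V)(y) = exp(−E_{j+1}(V)(y)) · Ψ_j(V)(ey)` (`Ψ_j = Φ_j⁻¹` as an explicit letter), over the
  record's centre contours `Γ_{y,x}` of file 3b (`ctrWord`, `ctrHol`, the contours of `siteAvgStep` = print's `Q′` (3.18)) and RELATIVE to the
  background (the factor `Ū^j(U₀)(Γ)⋆`, so that `Φ_j(↑U₀) = 1`: (78) at `U₀ = 1` verbatim, [Balaban1985Variational] (21) «`R₀ = 1`» in general);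
* §3  the datum `hierFrameDatumOfRecord F N K k U₀ : FrameDatum (F.P K) N k U₀` — `map = Ψ_k`, `inv = Φ_k`, window = the iterated polydisc of the
  (0.4) loop matrices and of the arguments of the logarithms, `deriv = fderiv ℂ Ψ_k (↑U₀)` — under the guard `SmallBelow (avOfRecord F N K) k U₀` of
  the record (outside it the letters `Ū^j(U₀)` are junk and the datum is DEFINED to be the frameless one: `hierFrameDatumOfRecord_of_not_smallBelow`);
* §4  ★★★ (F1) THE GERM ALONG GAUGE ORBITS: for `λ : sites → 𝔤ᶜ = 𝔰𝔩_N(ℂ)` (traceless) the derivative letter maps the chart direction of the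
  infinitesimal gauge transformation, `X = leftVelC U₀ (D_{U₀}λ)`, `(D_{U₀}λ)(b) = U₀(b)λ(b₊)U₀(b)⋆ − λ(b₋)`, to `λ∘emb^k − Q′_kλ`
  (`hierFrame_deriv_gauge`: CENTRE VALUE MINUS PRINT'S BLOCK MEAN (3.19), `Q′_k = siteAvgIter`), by differentiating the recursion along the complex
  gauge orbit `t ↦ (exp tλ) • ↑U₀` (§1) — print's computation p. 418 «`R_y(U′_u) = u(y)·exp[−Σ L^{-d} log u …]`»;
* §5  ★★★ (3.114): `Q^{pr}_k(U₀)(D_{U₀}λ)(c) = L^{-k}·(Ū₀(c)·(Q′_kλ)(c₊)·Ū₀(c)⋆ − (Q′_kλ)(c₋))` for traceless `λ` (`frameIntertwinesTokSL_hierFrame`,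
  the token `FrameIntertwinesTokSL`), from (F1) and the un-framed identity `q^{ff}(D_{U₀}λ) = L^{-k}·D_{Ū₀}(λ∘emb^k)` on `𝔰𝔩_N`-valued `λ`
  (`qCplxOp_covGrad_of_trace_zero`, from n07-w1's ✓`dIterL_apply_infGauge` and file 3b's complexification §1).

HONEST LIMIT (the extra `𝔤𝔩₁` direction of the tree's carriers).  Print's Lie algebra is `𝔤ᶜ = 𝔰𝔩_N(ℂ)`; the tree's bond∕site carriers are
`M_N(ℂ) = 𝔰𝔩_N ⊕ ℂ·1`-valued.  The holomorphic letters `holMh`∕`iterMh` continue inverses by ADJUGATES, which are `SL(N, ℂ)`- but not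
`GL(N, ℂ)`-covariant (`adj(e^{τ}W) = e^{(N−1)τ} adj W`), whereas file 3b's `qCplxOp` (the complexification of `fderiv ℝ iterM` from `𝔲(N)`-directions) is
covariant in the scalar direction too.  Consequently the identities of §4–§5 are stated and proved on TRACELESS `λ` — print's statement verbatim — and
file A2's all-matrix display `FrameIntertwinesTok` (which also quantifies over the scalar direction `λ = φ·1`) is NOT inhabited by this datum; it is
inhabited by the `GL`-completion `V ↦ e^{−F_k(σ(V))}·Ψ_k(V♮)` (`σ = N⁻¹ log det`, `V♮ = e^{−σ}V`, `F_k` the flat abelian frame functional), a separate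
construction not typed here.  Nothing of Bałaban's estimates ((81), (20)–(23) of [Balaban1985Averaging]) is proved here: analyticity on the window and
the first-order identities only.
-/

noncomputable section

open scoped Matrix Matrix.Norms.L2Operator Topology

namespace Literature.MathematicalPhysics.QuantumFieldTheory.Balaban1983to89.Node00

open Filter
open T4Continuum BlockAveraging B15DeterminingSets
open NormedSpace (exp)
open MatrixLog (mlog mlog_one analyticAt_mlog exp_mlog)
open B15AveragingHolomorphic (stepMh holMh holMh_nil holMh_cons loopMh axialMh corrMh avgMh iterMh iterMh_zero iterMh_succ holMh_coeField
  loopMh_coeField coeField_iter_eq_iterMh differentiableAt_iterMh)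
open B15AveragingAnalytic (analyticAt_holMh analyticAt_iterMh_of_polydisc)
open ExpMeanLog (eml eml_conj expMeanLogSU)
open T4AdjointCovarianceUnitary (lieSU mem_lieSU_iff)
open Literature.Analysis.Calculus (exp_neg_mul_exp exp_mul_exp_neg)

/-! ## §1. The complex gauge action through the holomorphic averaging letters ([Balaban1985Averaging] (8), (11); [Balaban1985Variational] p. 307) -/

section SLGauge

variable {P : Params} {j : ℕ} {N : ℕ}

/-- On `SL(N, ℂ)` the adjugate is the inverse. [cite: Balaban1985Variational, p.307 («Gᶜ-valued fields»; bookkeeping)] -/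
theorem adjugate_eq_inv_of_det_eq_one {A : Matrix (Fin N) (Fin N) ℂ} (hA : A.det = 1) : A.adjugate = A⁻¹ := by
  rw [Matrix.inv_def, hA, Ring.inverse_one, one_smul]

/-- The inverse of a determinant-one matrix has determinant one. [cite: Balaban1985Variational, p.307 (bookkeeping)] -/
theorem det_inv_eq_one_of_det_eq_one {A : Matrix (Fin N) (Fin N) ℂ} (hA : A.det = 1) : (A⁻¹).det = 1 := by
  rw [Matrix.det_nonsing_inv, hA, Ring.inverse_one]

/-- `adj (A⁻¹) = A` when `det A = 1`. [cite: Balaban1985Variational, p.307 (bookkeeping)] -/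
theorem adjugate_inv_eq_self_of_det_eq_one {A : Matrix (Fin N) (Fin N) ℂ} (hA : A.det = 1) : (A⁻¹).adjugate = A := by
  rw [adjugate_eq_inv_of_det_eq_one (det_inv_eq_one_of_det_eq_one hA), Matrix.nonsing_inv_nonsing_inv A (by rw [hA]; exact isUnit_one)]

/-- `A⁻¹ · A = 1` when `det A = 1`. [cite: Balaban1985Variational, p.307 (bookkeeping)] -/
theorem inv_mul_of_det_eq_one {A : Matrix (Fin N) (Fin N) ℂ} (hA : A.det = 1) : A⁻¹ * A = 1 :=
  Matrix.nonsing_inv_mul A (by rw [hA]; exact isUnit_one)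

/-- `A · A⁻¹ = 1` when `det A = 1`. [cite: Balaban1985Variational, p.307 (bookkeeping)] -/
theorem mul_inv_of_det_eq_one {A : Matrix (Fin N) (Fin N) ℂ} (hA : A.det = 1) : A * A⁻¹ = 1 :=
  Matrix.mul_nonsing_inv A (by rw [hA]; exact isUnit_one)

/-- Backward step of the `SL`-gauge-transformed field: `adj(G(b₋)·V(b)·G(b₊)⁻¹) = G(b₊)·adj V(b)·G(b₋)⁻¹`. [cite: Balaban1985Averaging, (8) p.18; Balaban1985Variational, p.307] -/
theorem stepMh_slGauge_bwd (G : Site P j → Matrix (Fin N) (Fin N) ℂ) (hG : ∀ x, (G x).det = 1) (V : PBond P j → Matrix (Fin N) (Fin N) ℂ) (b : PBond P j) :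
    stepMh (fun b => G b.src * V b * (G b.tgt)⁻¹) ⟨b, false⟩ = G b.tgt * stepMh V ⟨b, false⟩ * (G b.src)⁻¹ := by
  simp only [stepMh, Bool.false_eq_true, ↓reduceIte]
  rw [Matrix.adjugate_mul_distrib, Matrix.adjugate_mul_distrib, adjugate_inv_eq_self_of_det_eq_one (hG b.tgt),
    adjugate_eq_inv_of_det_eq_one (hG b.src), mul_assoc]

/-- ★ **[Balaban1985Averaging] (8) TELESCOPED, COMPLEX EDITION**: for an `SL(N, ℂ)`-valued site map `G` and ANY matrix field `V`,
`holMh (G • V) (walk x w) = G(x) · holMh V (walk x w) · G(walkEnd x w)⁻¹`. [cite: Balaban1985Averaging, (8) p.18, (11) p.19; Balaban1985Variational, p.307] -/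
theorem holMh_slGauge_walk (G : Site P j → Matrix (Fin N) (Fin N) ℂ) (hG : ∀ x, (G x).det = 1) (V : PBond P j → Matrix (Fin N) (Fin N) ℂ) :
    ∀ (x : Site P j) (w : List (Letter P.d)),
      holMh (fun b => G b.src * V b * (G b.tgt)⁻¹) (walk x w) = G x * holMh V (walk x w) * (G (walkEnd x w))⁻¹
  | x, [] => by
    simp only [walk, walkEnd, holMh_nil, mul_one]
    rw [mul_inv_of_det_eq_one (hG x)]
  | x, (μ, true) :: w => by
    rw [walk, walkEnd, holMh_cons, holMh_cons, holMh_slGauge_walk G hG V (x.shift μ) w]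
    simp only [stepMh, ↓reduceIte, PBond.tgt]
    rw [show G x * V ⟨x, μ⟩ * (G (x.shift μ))⁻¹ * (G (x.shift μ) * holMh V (walk (x.shift μ) w) * (G (walkEnd (x.shift μ) w))⁻¹)
        = G x * V ⟨x, μ⟩ * ((G (x.shift μ))⁻¹ * G (x.shift μ)) * holMh V (walk (x.shift μ) w) * (G (walkEnd (x.shift μ) w))⁻¹ by
          simp only [mul_assoc],
      inv_mul_of_det_eq_one (hG _), mul_one]
    simp only [mul_assoc]
  | x, (μ, false) :: w => by
    have hus : (x.unshift μ).shift μ = x := by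
      funext ν
      by_cases h : ν = μ
      · subst h
        simp [Site.shift, Site.unshift]
      · simp [Site.shift_apply, Site.unshift_apply, h]
    rw [walk, walkEnd, holMh_cons, holMh_cons, holMh_slGauge_walk G hG V (x.unshift μ) w, stepMh_slGauge_bwd G hG V]
    simp only [PBond.tgt, hus]
    rw [show G x * stepMh V ⟨⟨x.unshift μ, μ⟩, false⟩ * (G (x.unshift μ))⁻¹ *
          (G (x.unshift μ) * holMh V (walk (x.unshift μ) w) * (G (walkEnd (x.unshift μ) w))⁻¹)
        = G x * stepMh V ⟨⟨x.unshift μ, μ⟩, false⟩ * ((G (x.unshift μ))⁻¹ * G (x.unshift μ)) * holMh V (walk (x.unshift μ) w) *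
          (G (walkEnd (x.unshift μ) w))⁻¹ by simp only [mul_assoc],
      inv_mul_of_det_eq_one (hG _), mul_one]
    simp only [mul_assoc]

/-- Closed loops conjugate: `loopMh (G • V) c i = G(emb c₋) · loopMh V c i · G(emb c₋)⁻¹`. [cite: Balaban1987RG1, (0.4) p.253; Balaban1985Averaging, (12) p.19] -/
theorem loopMh_slGauge (G : Site P j → Matrix (Fin N) (Fin N) ℂ) (hG : ∀ x, (G x).det = 1) (V : PBond P j → Matrix (Fin N) (Fin N) ℂ)
    (c : PBond P (j + 1)) (i : Idx P) :
    loopMh (fun b => G b.src * V b * (G b.tgt)⁻¹) c i = G (emb c.src) * loopMh V c i * (G (emb c.src))⁻¹ := by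
  unfold loopMh
  rw [holMh_slGauge_walk G hG V, walkEnd_eq_self_of_netDisp]
  intro ν
  rw [netDisp_loopWord, Int.cast_zero]

/-- The straight segment: `axialMh (G • V) c = G(emb c₋) · axialMh V c · G(emb c₊)⁻¹`. [cite: Balaban1987RG1, (0.4) p.253; Balaban1985Averaging, (8) p.18] -/
theorem axialMh_slGauge (G : Site P j → Matrix (Fin N) (Fin N) ℂ) (hG : ∀ x, (G x).det = 1) (V : PBond P j → Matrix (Fin N) (Fin N) ℂ)
    (c : PBond P (j + 1)) :
    axialMh (fun b => G b.src * V b * (G b.tgt)⁻¹) c = G (emb c.src) * axialMh V c * (G (emb c.tgt))⁻¹ := by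
  unfold axialMh
  rw [holMh_slGauge_walk G hG V, walkEnd_replicate_L]
  rfl

/-- The correction factor: `corrMh (G • V) c = G(emb c₋) · corrMh V c · G(emb c₋)⁻¹` (`eml_conj`, no smallness). [cite: Balaban1987RG1, (0.6) p.253] -/
theorem corrMh_slGauge (G : Site P j → Matrix (Fin N) (Fin N) ℂ) (hG : ∀ x, (G x).det = 1) (V : PBond P j → Matrix (Fin N) (Fin N) ℂ)
    (c : PBond P (j + 1)) :
    corrMh (fun b => G b.src * V b * (G b.tgt)⁻¹) c = G (emb c.src) * corrMh V c * (G (emb c.src))⁻¹ := by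
  unfold corrMh
  have hl : (fun i : Idx P => loopMh (fun b => G b.src * V b * (G b.tgt)⁻¹) c i) = fun i => G (emb c.src) * loopMh V c i * (G (emb c.src))⁻¹ :=
    funext fun i => loopMh_slGauge G hG V c i
  rw [hl, eml_conj (mul_inv_of_det_eq_one (hG _)) (inv_mul_of_det_eq_one (hG _))]

/-- ★★ **COMPLEX GAUGE COVARIANCE OF THE HOLOMORPHIC (0.4) AVERAGING**: `avgMh (G • V) c = G(emb c₋) · avgMh V c · G(emb c₊)⁻¹` for every
`SL(N, ℂ)`-valued site map `G` and every matrix field `V`. [cite: Balaban1985Averaging, (11) p.19; Balaban1987RG1, (0.4) p.253, (0.6) p.253; Balaban1985Variational, p.307] -/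
theorem avgMh_slGauge (G : Site P j → Matrix (Fin N) (Fin N) ℂ) (hG : ∀ x, (G x).det = 1) (V : PBond P j → Matrix (Fin N) (Fin N) ℂ)
    (c : PBond P (j + 1)) :
    avgMh (fun b => G b.src * V b * (G b.tgt)⁻¹) c = G (emb c.src) * avgMh V c * (G (emb c.tgt))⁻¹ := by
  show corrMh _ c * axialMh _ c = G (emb c.src) * (corrMh V c * axialMh V c) * (G (emb c.tgt))⁻¹
  rw [corrMh_slGauge G hG V c, axialMh_slGauge G hG V c,
    show G (emb c.src) * corrMh V c * (G (emb c.src))⁻¹ * (G (emb c.src) * axialMh V c * (G (emb c.tgt))⁻¹)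
      = G (emb c.src) * corrMh V c * ((G (emb c.src))⁻¹ * G (emb c.src)) * axialMh V c * (G (emb c.tgt))⁻¹ by simp only [mul_assoc],
    inv_mul_of_det_eq_one (hG _), mul_one]
  simp only [mul_assoc]

/-- ★★ **THE ITERATE**: `Ū^k_h(G • V) = (G ∘ emb^k) • Ū^k_h(V)` for `SL(N, ℂ)`-valued `G` on the finest lattice. [cite: Balaban1985Averaging, (11) p.19; Balaban1987RG1, (0.21) p.256] -/
theorem iterMh_slGauge (G : Site P 0 → Matrix (Fin N) (Fin N) ℂ) (hG : ∀ x, (G x).det = 1) (V : PBond P 0 → Matrix (Fin N) (Fin N) ℂ) :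
    ∀ k : ℕ, iterMh k (fun b => G b.src * V b * (G b.tgt)⁻¹) = fun c => G (embIter k c.src) * iterMh k V c * (G (embIter k c.tgt))⁻¹
  | 0 => rfl
  | k + 1 => by
    rw [iterMh_succ, iterMh_succ, iterMh_slGauge G hG V k]
    exact funext fun c => avgMh_slGauge (fun y : Site P k => G (embIter k y)) (fun y => hG _) (iterMh k V) c

/-- The one-parameter complex gauge orbit `t ↦ (exp tλ) • ↑U₀` through the background: `b ↦ exp(tλ(b₋))·U₀(b)·exp(tλ(b₊))⁻¹`.
[cite: Balaban1985BackgroundPropagators, p.418 («U′ ↦ U′^u, u = e^{iλ}»); Balaban1985Variational, p.307] -/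
def slOrbit (U₀ : GaugeField P 0 (SU N)) (lam : Site P 0 → Matrix (Fin N) (Fin N) ℂ) (t : ℂ) : PBond P 0 → Matrix (Fin N) (Fin N) ℂ :=
  fun b => exp (t • lam b.src) * (U₀ b : Matrix (Fin N) (Fin N) ℂ) * (exp (t • lam b.tgt))⁻¹

/-- Unfolding of `slOrbit` (`rfl`). [cite: Balaban1985BackgroundPropagators, p.418 (bookkeeping)] -/
theorem slOrbit_apply (U₀ : GaugeField P 0 (SU N)) (lam : Site P 0 → Matrix (Fin N) (Fin N) ℂ) (t : ℂ) (b : PBond P 0) :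
    slOrbit U₀ lam t b = exp (t • lam b.src) * (U₀ b : Matrix (Fin N) (Fin N) ℂ) * (exp (t • lam b.tgt))⁻¹ := rfl

/-- At `t = 0` the orbit is the background. [cite: Balaban1985BackgroundPropagators, p.418 (bookkeeping)] -/
theorem slOrbit_zero (U₀ : GaugeField P 0 (SU N)) (lam : Site P 0 → Matrix (Fin N) (Fin N) ℂ) : slOrbit U₀ lam 0 = coeField U₀ := by
  funext b
  rw [slOrbit_apply, zero_smul, zero_smul, NormedSpace.exp_zero, inv_one, one_mul, mul_one, coeField_apply]

/-- `det exp(tλ) = 1` for traceless `λ` (`det exp = exp tr`). [cite: Balaban1985Variational, p.307 (bookkeeping)] -/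
theorem det_exp_smul_eq_one_of_trace_eq_zero {A : Matrix (Fin N) (Fin N) ℂ} (hA : A.trace = 0) (t : ℂ) : (exp (t • A)).det = 1 := by
  rw [Literature.Analysis.Matrix.det_exp_eq_exp_trace, Matrix.trace_smul, hA, smul_zero, NormedSpace.exp_zero]

/-- `t ↦ exp(tA)·C·exp(tB)⁻¹` has derivative `A·C − C·B` at `t = 0`. [cite: Balaban1985BackgroundPropagators, p.418 (bookkeeping)] -/
theorem hasDerivAt_exp_conj_zero (A C B : Matrix (Fin N) (Fin N) ℂ) :
    HasDerivAt (fun t : ℂ => exp (t • A) * C * (exp (t • B))⁻¹) (A * C - C * B) 0 := by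
  have hfun : (fun t : ℂ => exp (t • A) * C * (exp (t • B))⁻¹) = fun t : ℂ => exp (t • A) * C * exp (t • (-B)) := by
    funext t
    rw [smul_neg, Matrix.exp_neg]
  rw [hfun]
  have hA := hasDerivAt_exp_smul_const' (𝕂 := ℂ) A (0 : ℂ)
  have hB := hasDerivAt_exp_smul_const' (𝕂 := ℂ) (-B) (0 : ℂ)
  have h : HasDerivAt (fun t : ℂ => exp (t • A) * C * exp (t • (-B))) (A * exp ((0 : ℂ) • A) * C * exp ((0 : ℂ) • (-B)) +
      exp ((0 : ℂ) • A) * C * (-B * exp ((0 : ℂ) • (-B)))) 0 := (hA.mul_const C).mul hB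
  refine h.congr_deriv ?_
  simp only [zero_smul, NormedSpace.exp_zero, mul_one, one_mul, mul_neg, sub_eq_add_neg]

/-- The velocity of the orbit at the background: `b ↦ λ(b₋)·U₀(b) − U₀(b)·λ(b₊)`. [cite: Balaban1985BackgroundPropagators, (3.1)–(3.2) p.390, p.418] -/
theorem hasDerivAt_slOrbit_zero (U₀ : GaugeField P 0 (SU N)) (lam : Site P 0 → Matrix (Fin N) (Fin N) ℂ) :
    HasDerivAt (slOrbit U₀ lam)
      (fun b => lam b.src * (U₀ b : Matrix (Fin N) (Fin N) ℂ) - (U₀ b : Matrix (Fin N) (Fin N) ℂ) * lam b.tgt) 0 :=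
  hasDerivAt_pi.2 fun b => hasDerivAt_exp_conj_zero (lam b.src) (U₀ b : Matrix (Fin N) (Fin N) ℂ) (lam b.tgt)

/-- ★ Along a traceless orbit the holomorphic iterate is conjugated at the block centres:
`Ū^j_h((exp tλ) • ↑U₀)(c) = exp(tλ(emb^j c₋)) · Ū^j_h(↑U₀)(c) · exp(tλ(emb^j c₊))⁻¹`. [cite: Balaban1985Averaging, (11) p.19; Balaban1987RG1, (0.21) p.256] -/
theorem iterMh_slOrbit (U₀ : GaugeField P 0 (SU N)) {lam : Site P 0 → Matrix (Fin N) (Fin N) ℂ} (hlam : ∀ x, (lam x).trace = 0) (t : ℂ) (j : ℕ) :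
    iterMh j (slOrbit U₀ lam t) =
      fun c => exp (t • lam (embIter j c.src)) * iterMh j (coeField U₀) c * (exp (t • lam (embIter j c.tgt)))⁻¹ :=
  iterMh_slGauge (fun x => exp (t • lam x)) (fun x => det_exp_smul_eq_one_of_trace_eq_zero (hlam x) t) (coeField U₀) j

end SLGauge

/-! ## §2. Print's hierarchical frame (84)–(87) over the record's centre contours, relative to the background -/

section HierFrame

variable {P : Params} {N : ℕ} [NeZero N] {j : ℕ}

/-- The transporter of a level-`j` MATRIX field along the centre contour `Γ_{y,x_r}` (file 3b's `ctrWord`; holomorphic letters, adjugates on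
backward steps). [cite: Balaban1985Averaging, (42) p.23, (78) p.30; Balaban1985BackgroundPropagators, (3.18) p.393] -/
def ctrHolM (Z : PBond P j → Matrix (Fin N) (Fin N) ℂ) (y : Site P (j + 1)) (r : Fin P.d → Fin P.L) : Matrix (Fin N) (Fin N) ℂ :=
  holMh Z (walk (emb y) (ctrWord P r))

/-- On `SU(N)` data the matrix transporter is file 3b's `ctrHol`. [cite: Balaban1985BackgroundPropagators, (3.19) p.393 (bookkeeping)] -/
theorem ctrHolM_coeField (W : GaugeField P j (SU N)) (y : Site P (j + 1)) (r : Fin P.d → Fin P.L) :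
    ctrHolM (coeField W) y r = ((ctrHol W y r : SU N) : Matrix (Fin N) (Fin N) ℂ) := by
  rw [ctrHolM, holMh_coeField, ← coe_holAt]; rfl

/-- ★ **THE ARGUMENT OF THE LOGARITHM IN (85)**, relative to the background: `Ψ(ey) · Z(Γ_{y,x_r}) · Φ(x_r) · W(Γ_{y,x_r})⋆` for a level-`j` matrix
field `Z` (the un-framed `j`-fold average of `V`), the background's `j`-fold average `W`, and the pair `(Φ, Ψ) = (R^{(j)}, (R^{(j)})⁻¹)`.
[cite: Balaban1985Averaging, (78)–(79) p.30, (85) p.30] -/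
def frameArg (Z : PBond P j → Matrix (Fin N) (Fin N) ℂ) (W : GaugeField P j (SU N))
    (Θ : Site P j → Matrix (Fin N) (Fin N) ℂ × Matrix (Fin N) (Fin N) ℂ) (y : Site P (j + 1)) (r : Fin P.d → Fin P.L) : Matrix (Fin N) (Fin N) ℂ :=
  (Θ (emb y)).2 * ctrHolM Z y r * (Θ (Site.blockSite y r)).1 * star ((ctrHol W y r : SU N) : Matrix (Fin N) (Fin N) ℂ)

/-- ★ **THE EXPONENT OF (85)**: `E(y) = L^{-d} Σ_{x ∈ B(y)} log(frameArg y x)`. [cite: Balaban1985Averaging, (79) p.30, (85) p.30] -/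
def frameExpo (Z : PBond P j → Matrix (Fin N) (Fin N) ℂ) (W : GaugeField P j (SU N))
    (Θ : Site P j → Matrix (Fin N) (Fin N) ℂ × Matrix (Fin N) (Fin N) ℂ) (y : Site P (j + 1)) : Matrix (Fin N) (Fin N) ℂ :=
  ((P.L : ℂ) ^ P.d)⁻¹ • ∑ r : Fin P.d → Fin P.L, mlog (frameArg Z W Θ y r)

/-- ★ **ONE STEP OF (86)–(87)**: `(Φ, Ψ) ↦ (y ↦ (Φ(ey)·exp E(y), exp(−E(y))·Ψ(ey)))`. [cite: Balaban1985Averaging, (80) p.30, (86)–(87) p.31] -/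
def frameStep (Z : PBond P j → Matrix (Fin N) (Fin N) ℂ) (W : GaugeField P j (SU N))
    (Θ : Site P j → Matrix (Fin N) (Fin N) ℂ × Matrix (Fin N) (Fin N) ℂ) :
    Site P (j + 1) → Matrix (Fin N) (Fin N) ℂ × Matrix (Fin N) (Fin N) ℂ :=
  fun y => ((Θ (emb y)).1 * exp (frameExpo Z W Θ y), exp (-frameExpo Z W Θ y) * (Θ (emb y)).2)

/-- ★★ **THE HIERARCHICAL FRAME PAIR `(R^{(j)}(V), R^{(j)}(V)⁻¹)`** of a complexified fine bond field `V` along an averaging family `av` and relative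
to the background `U₀`: `(Φ₀, Ψ₀) = (1, 1)`, `(Φ_{j+1}, Ψ_{j+1}) = frameStep (Ū^j_h V) (Ū^j U₀) (Φ_j, Ψ_j)`.
[cite: Balaban1985Averaging, (84)–(88) pp.30–31; Balaban1985Variational, (21) p.281] -/
def framePair (av : ∀ j, Averaging P j (SU N)) (U₀ : GaugeField P 0 (SU N)) (V : PBond P 0 → Matrix (Fin N) (Fin N) ℂ) :
    (j : ℕ) → Site P j → Matrix (Fin N) (Fin N) ℂ × Matrix (Fin N) (Fin N) ℂ
  | 0 => fun _ => (1, 1)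
  | j + 1 => frameStep (iterMh j V) (Averaging.iter av j U₀) (framePair av U₀ V j)

/-- `(Φ₀, Ψ₀) = (1, 1)` (`rfl`). [cite: Balaban1985Averaging, (84) p.30 (bookkeeping)] -/
@[simp] theorem framePair_zero (av : ∀ j, Averaging P j (SU N)) (U₀ : GaugeField P 0 (SU N)) (V : PBond P 0 → Matrix (Fin N) (Fin N) ℂ)
    (x : Site P 0) : framePair av U₀ V 0 x = (1, 1) := rfl

/-- The recursion step (`rfl`). [cite: Balaban1985Averaging, (86)–(87) p.31 (bookkeeping)] -/
theorem framePair_succ (av : ∀ j, Averaging P j (SU N)) (U₀ : GaugeField P 0 (SU N)) (V : PBond P 0 → Matrix (Fin N) (Fin N) ℂ) (j : ℕ) :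
    framePair av U₀ V (j + 1) = frameStep (iterMh j V) (Averaging.iter av j U₀) (framePair av U₀ V j) := rfl

/-- ★ **`Ψ_j · Φ_j = 1` FOR EVERY FIELD** (the inverse frame is an explicit letter, not `Ring.inverse`). [cite: Balaban1985Averaging, (86)–(87) p.31] -/
theorem framePair_snd_mul_fst (av : ∀ j, Averaging P j (SU N)) (U₀ : GaugeField P 0 (SU N)) (V : PBond P 0 → Matrix (Fin N) (Fin N) ℂ) :
    ∀ (j : ℕ) (y : Site P j), (framePair av U₀ V j y).2 * (framePair av U₀ V j y).1 = 1
  | 0, y => by simp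
  | j + 1, y => by
    rw [framePair_succ]
    simp only [frameStep]
    rw [show exp (-frameExpo (iterMh j V) (Averaging.iter av j U₀) (framePair av U₀ V j) y) * (framePair av U₀ V j (emb y)).2 *
          ((framePair av U₀ V j (emb y)).1 * exp (frameExpo (iterMh j V) (Averaging.iter av j U₀) (framePair av U₀ V j) y))
        = exp (-frameExpo (iterMh j V) (Averaging.iter av j U₀) (framePair av U₀ V j) y) *
            ((framePair av U₀ V j (emb y)).2 * (framePair av U₀ V j (emb y)).1) *
            exp (frameExpo (iterMh j V) (Averaging.iter av j U₀) (framePair av U₀ V j) y) by simp only [mul_assoc],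
      framePair_snd_mul_fst av U₀ V j (emb y), mul_one, exp_neg_mul_exp (𝔸 := Matrix (Fin N) (Fin N) ℂ)]

/-- ★ `Φ_j · Ψ_j = 1` as well. [cite: Balaban1985Averaging, (86)–(87) p.31] -/
theorem framePair_fst_mul_snd (av : ∀ j, Averaging P j (SU N)) (U₀ : GaugeField P 0 (SU N)) (V : PBond P 0 → Matrix (Fin N) (Fin N) ℂ) :
    ∀ (j : ℕ) (y : Site P j), (framePair av U₀ V j y).1 * (framePair av U₀ V j y).2 = 1
  | 0, y => by simp
  | j + 1, y => by
    rw [framePair_succ]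
    simp only [frameStep]
    rw [show (framePair av U₀ V j (emb y)).1 * exp (frameExpo (iterMh j V) (Averaging.iter av j U₀) (framePair av U₀ V j) y) *
          (exp (-frameExpo (iterMh j V) (Averaging.iter av j U₀) (framePair av U₀ V j) y) * (framePair av U₀ V j (emb y)).2)
        = (framePair av U₀ V j (emb y)).1 *
            (exp (frameExpo (iterMh j V) (Averaging.iter av j U₀) (framePair av U₀ V j) y) *
              exp (-frameExpo (iterMh j V) (Averaging.iter av j U₀) (framePair av U₀ V j) y)) *
            (framePair av U₀ V j (emb y)).2 by simp only [mul_assoc],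
      exp_mul_exp_neg (𝔸 := Matrix (Fin N) (Fin N) ℂ), mul_one, framePair_fst_mul_snd av U₀ V j (emb y)]

omit [NeZero N] in
/-- `log ∘ f` is analytic where `f` is, on the unit ball about `1`. [cite: Balaban1985Averaging, (21) p.21 (bookkeeping)] -/
theorem analyticAt_mlog_comp {X : Type*} [NormedAddCommGroup X] [NormedSpace ℂ X] {f : X → Matrix (Fin N) (Fin N) ℂ} {x : X}
    (hf : AnalyticAt ℂ f x) (h1 : ‖f x - 1‖ < 1) : AnalyticAt ℂ (fun z => mlog (f z)) x :=
  (analyticAt_mlog h1).comp hf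

/-- ★ **THE WINDOW**: the iterated polydisc — every (0.4) loop matrix of every iterate `< k` and every argument of the logarithms of (85) below `k` lies in
the unit ball about `1` (where `eml` and `log` are analytic). [cite: Balaban1985Averaging, (81) p.30, (85) p.30; Balaban1987RG1, (0.4) p.253] -/
def hierFrameDom (av : ∀ j, Averaging P j (SU N)) (U₀ : GaugeField P 0 (SU N)) (k : ℕ) : Set (PBond P 0 → Matrix (Fin N) (Fin N) ℂ) :=
  {V | ∀ j, j < k →
    (∀ (c : PBond P (j + 1)) (i : Idx P), ‖loopMh (iterMh j V) c i - 1‖ < 1) ∧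
      ∀ (y : Site P (j + 1)) (r : Fin P.d → Fin P.L), ‖frameArg (iterMh j V) (Averaging.iter av j U₀) (framePair av U₀ V j) y r - 1‖ < 1}

/-- ★★ **ANALYTICITY OF THE FRAME PAIR ON THE WINDOW** ([Balaban1985Variational] Sect. G: compositions of walk products, the analytic iterate, `log` on
the unit ball, `exp`). [cite: Balaban1985Variational, Prop. 9 p.309; Balaban1985Averaging, (81) p.30, (85)–(87) pp.30–31] -/
theorem analyticAt_framePair (av : ∀ j, Averaging P j (SU N)) (U₀ : GaugeField P 0 (SU N)) {V : PBond P 0 → Matrix (Fin N) (Fin N) ℂ} :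
    ∀ j : ℕ, (∀ j', j' < j →
      (∀ (c : PBond P (j' + 1)) (i : Idx P), ‖loopMh (iterMh j' V) c i - 1‖ < 1) ∧
        ∀ (y : Site P (j' + 1)) (r : Fin P.d → Fin P.L), ‖frameArg (iterMh j' V) (Averaging.iter av j' U₀) (framePair av U₀ V j') y r - 1‖ < 1) →
      ∀ y : Site P j,
        AnalyticAt ℂ (fun V => (framePair av U₀ V j y).1) V ∧ AnalyticAt ℂ (fun V => (framePair av U₀ V j y).2) V
  | 0, _, y => ⟨analyticAt_const, analyticAt_const⟩
  | j + 1, h, y => by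
    have ih := analyticAt_framePair av U₀ j fun j' hj' => h j' (Nat.lt_succ_of_lt hj')
    have hj := h j (Nat.lt_succ_self j)
    have hit : AnalyticAt ℂ (iterMh j : (PBond P 0 → Matrix (Fin N) (Fin N) ℂ) → PBond P j → Matrix (Fin N) (Fin N) ℂ) V :=
      analyticAt_iterMh_of_polydisc j fun j' hj' => (h j' (Nat.lt_succ_of_lt hj')).1
    have harg : ∀ r : Fin P.d → Fin P.L,
        AnalyticAt ℂ (fun V => frameArg (iterMh j V) (Averaging.iter av j U₀) (framePair av U₀ V j) y r) V := fun r =>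
      ((((ih (emb y)).2.mul ((analyticAt_holMh (iterMh j V) _).comp hit)).mul (ih (Site.blockSite y r)).1).mul analyticAt_const)
    have hE : AnalyticAt ℂ (fun V => frameExpo (iterMh j V) (Averaging.iter av j U₀) (framePair av U₀ V j) y) V := by
      have hsum : AnalyticAt ℂ (fun V => ∑ r : Fin P.d → Fin P.L, mlog (frameArg (iterMh j V) (Averaging.iter av j U₀) (framePair av U₀ V j) y r)) V :=
        Finset.analyticAt_fun_sum (f := fun (r : Fin P.d → Fin P.L) (V : PBond P 0 → Matrix (Fin N) (Fin N) ℂ) =>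
          mlog (frameArg (iterMh j V) (Averaging.iter av j U₀) (framePair av U₀ V j) y r)) Finset.univ
          fun r _ => analyticAt_mlog_comp (harg r) (hj.2 y r)
      show AnalyticAt ℂ (fun V => ((P.L : ℂ) ^ P.d)⁻¹ •
        ∑ r : Fin P.d → Fin P.L, mlog (frameArg (iterMh j V) (Averaging.iter av j U₀) (framePair av U₀ V j) y r)) V
      exact (analyticAt_const (v := ((P.L : ℂ) ^ P.d)⁻¹)).smul hsum
    have hexp : AnalyticAt ℂ (fun V => exp (frameExpo (iterMh j V) (Averaging.iter av j U₀) (framePair av U₀ V j) y)) V :=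
      (NormedSpace.exp_analytic (𝕂 := ℂ) _).comp hE
    have hexpn : AnalyticAt ℂ (fun V => exp (-frameExpo (iterMh j V) (Averaging.iter av j U₀) (framePair av U₀ V j) y)) V :=
      (NormedSpace.exp_analytic (𝕂 := ℂ) _).comp hE.neg
    exact ⟨(ih (emb y)).1.mul hexp, hexpn.mul (ih (emb y)).2⟩

end HierFrame

/-! ## §3. The record's datum `hierFrameDatumOfRecord F N k U₀ : FrameDatum (F.P K) N k U₀` -/

section Record

variable (F : T4Family) (N : ℕ) [NeZero N] {K : ℕ} (k : ℕ) (U₀ : GaugeField (F.P K) 0 (SU N))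

/-- ★ **AT THE BACKGROUND THE FRAME IS TRIVIAL AT EVERY LEVEL `≤ k`** under the record's guard below `k`: `(Φ_j, Ψ_j)(↑U₀) = (1, 1)` — the arguments of the
logarithms are `Ū^j(U₀)(Γ)·Ū^j(U₀)(Γ)⋆ = 1` (`iterMh_coeField_of_smallBelow`: the holomorphic iterate at `↑U₀` IS `↑(Ū^jU₀)` on the guard).
[cite: Balaban1985Averaging, (78) p.30, (84)–(87) pp.30–31; Balaban1985Variational, (21) p.281 («R₀ = 1»)] -/
theorem framePair_coeField_of_smallBelow {k : ℕ} (hU₀ : SmallBelow (avOfRecord F N K) k U₀) :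
    ∀ j, j ≤ k → framePair (avOfRecord F N K) U₀ (coeField U₀) j = fun _ => (1, 1)
  | 0, _ => rfl
  | j + 1, hj => by
    have hjk : j < k := hj
    have ih := framePair_coeField_of_smallBelow hU₀ j hjk.le
    have hit : iterMh j (coeField U₀) = coeField (Averaging.iter (avOfRecord F N K) j U₀) :=
      iterMh_coeField_of_smallBelow F N j U₀ (hU₀.mono hjk.le)
    funext y
    rw [framePair_succ, ih, hit]
    have harg : ∀ r : Fin (F.P K).d → Fin (F.P K).L,
        frameArg (coeField (Averaging.iter (avOfRecord F N K) j U₀)) (Averaging.iter (avOfRecord F N K) j U₀)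
          (fun _ => ((1 : Matrix (Fin N) (Fin N) ℂ), (1 : Matrix (Fin N) (Fin N) ℂ))) y r = 1 := fun r => by
      rw [frameArg, ctrHolM_coeField, one_mul, mul_one, coe_mul_star_coe_SU]
    have hE : frameExpo (coeField (Averaging.iter (avOfRecord F N K) j U₀)) (Averaging.iter (avOfRecord F N K) j U₀)
        (fun _ => ((1 : Matrix (Fin N) (Fin N) ℂ), (1 : Matrix (Fin N) (Fin N) ℂ))) y = 0 := by
      rw [frameExpo]
      simp_rw [harg, mlog_one]
      rw [Finset.sum_const_zero, smul_zero]
    simp only [frameStep, hE, neg_zero, NormedSpace.exp_zero, mul_one]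

/-- The arguments of the logarithms at the background are `1`, at every level `< k`. [cite: Balaban1985Averaging, (78) p.30 (bookkeeping)] -/
theorem frameArg_coeField_of_smallBelow {k : ℕ} (hU₀ : SmallBelow (avOfRecord F N K) k U₀) {j : ℕ} (hj : j < k)
    (y : Site (F.P K) (j + 1)) (r : Fin (F.P K).d → Fin (F.P K).L) :
    frameArg (iterMh j (coeField U₀)) (Averaging.iter (avOfRecord F N K) j U₀) (framePair (avOfRecord F N K) U₀ (coeField U₀) j) y r = 1 := by
  rw [framePair_coeField_of_smallBelow F N U₀ hU₀ j hj.le, iterMh_coeField_of_smallBelow F N j U₀ (hU₀.mono hj.le), frameArg,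
    ctrHolM_coeField, one_mul, mul_one, coe_mul_star_coe_SU]

/-- ★ **THE BACKGROUND LIES IN THE WINDOW** under the guard (loop matrices in the polydisc by n07-e's `norm_loopM_coeField_sub_one_lt_one`; arguments
of the logarithms `= 1`). [cite: Balaban1987RG1, (0.4) p.253; Balaban1985Averaging, (81) p.30] -/
theorem coeField_mem_hierFrameDom {k : ℕ} (hU₀ : SmallBelow (avOfRecord F N K) k U₀) :
    coeField U₀ ∈ hierFrameDom (avOfRecord F N K) U₀ k := by
  intro j hj
  refine ⟨fun c i => ?_, fun y r => ?_⟩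
  · rw [iterMh_coeField_of_smallBelow F N j U₀ (hU₀.mono hj.le), loopMh_coeField]
    exact norm_loopM_coeField_sub_one_lt_one _ c (hU₀ j hj c) i
  · rw [frameArg_coeField_of_smallBelow F N U₀ hU₀ hj, sub_self, norm_zero]
    exact one_pos

/-- ★ **THE WINDOW IS A NEIGHBOURHOOD OF THE BACKGROUND** (finitely many strict inequalities on continuous — indeed analytic — functions of `V`, all
satisfied at `↑U₀`). [cite: Balaban1985Averaging, (81) p.30; Balaban1985Variational, Prop. 9 p.309] -/
theorem hierFrameDom_mem_nhds {k : ℕ} (hU₀ : SmallBelow (avOfRecord F N K) k U₀) :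
    hierFrameDom (avOfRecord F N K) U₀ k ∈ 𝓝 (coeField U₀) := by
  have hmem := coeField_mem_hierFrameDom F N U₀ hU₀
  have hopen : IsOpen {X : Matrix (Fin N) (Fin N) ℂ | ‖X - 1‖ < 1} :=
    isOpen_lt (continuous_norm.comp (continuous_id.sub continuous_const)) continuous_const
  have hall : ∀ j : Fin k, ∀ᶠ V in 𝓝 (coeField U₀),
      (∀ (c : PBond (F.P K) (j.1 + 1)) (i : Idx (F.P K)), ‖loopMh (iterMh j.1 V) c i - 1‖ < 1) ∧
        ∀ (y : Site (F.P K) (j.1 + 1)) (r : Fin (F.P K).d → Fin (F.P K).L),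
          ‖frameArg (iterMh j.1 V) (Averaging.iter (avOfRecord F N K) j.1 U₀) (framePair (avOfRecord F N K) U₀ V j.1) y r - 1‖ < 1 := by
    intro j
    have hit : AnalyticAt ℂ (iterMh j.1 : (PBond (F.P K) 0 → Matrix (Fin N) (Fin N) ℂ) → PBond (F.P K) j.1 → Matrix (Fin N) (Fin N) ℂ)
        (coeField U₀) := analyticAt_iterMh_of_polydisc j.1 fun j' hj' => (hmem j' (hj'.trans j.2)).1
    have hfp := analyticAt_framePair (avOfRecord F N K) U₀ (V := coeField U₀) j.1 fun j' hj' => hmem j' (hj'.trans j.2)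
    refine Filter.Eventually.and (Filter.eventually_all.2 fun c => Filter.eventually_all.2 fun i => ?_)
      (Filter.eventually_all.2 fun y => Filter.eventually_all.2 fun r => ?_)
    · have hc : ContinuousAt (fun V : PBond (F.P K) 0 → Matrix (Fin N) (Fin N) ℂ => loopMh (iterMh j.1 V) c i) (coeField U₀) :=
        ((analyticAt_holMh _ _).comp hit).continuousAt
      exact hc.preimage_mem_nhds (hopen.mem_nhds ((hmem j.1 j.2).1 c i))
    · have hc : ContinuousAt (fun V : PBond (F.P K) 0 → Matrix (Fin N) (Fin N) ℂ =>
          frameArg (iterMh j.1 V) (Averaging.iter (avOfRecord F N K) j.1 U₀) (framePair (avOfRecord F N K) U₀ V j.1) y r) (coeField U₀) :=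
        ((((hfp (emb y)).2.mul ((analyticAt_holMh _ _).comp hit)).mul (hfp (Site.blockSite y r)).1).mul analyticAt_const).continuousAt
      exact hc.preimage_mem_nhds (hopen.mem_nhds ((hmem j.1 j.2).2 y r))
  have hev : ∀ᶠ V in 𝓝 (coeField U₀), ∀ j : Fin k,
      (∀ (c : PBond (F.P K) (j.1 + 1)) (i : Idx (F.P K)), ‖loopMh (iterMh j.1 V) c i - 1‖ < 1) ∧
        ∀ (y : Site (F.P K) (j.1 + 1)) (r : Fin (F.P K).d → Fin (F.P K).L),
          ‖frameArg (iterMh j.1 V) (Averaging.iter (avOfRecord F N K) j.1 U₀) (framePair (avOfRecord F N K) U₀ V j.1) y r - 1‖ < 1 :=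
    Filter.eventually_all.2 hall
  filter_upwards [hev] with V hV
  exact fun j hj => hV ⟨j, hj⟩

/-- ★★★ **THE RECORD'S FRAME DATUM AT THE BACKGROUND `U₀`** — print's hierarchical frame of order `k` ((84)–(87) over the record's centre contours, relative
to `U₀`) as an inhabitant of file A2's `FrameDatum`: `map = Ψ_k = (R^{(k)})⁻¹`, `inv = Φ_k = R^{(k)}`, window = the iterated polydisc `hierFrameDom`,
`deriv = fderiv ℂ Ψ_k (↑U₀)`; DEFINED under the record's small-field guard below `k` (outside it: the frameless datum, `…_of_not_smallBelow`).  With this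
datum `avPrM` is the framed average (92): `Ū^{pr}(V)(c) = Ψ_k(V)(c₋)·Ū^k_h(V)(c)·Φ_k(V)(c₊)` — (80)∕(92) with `R₀ = 1`.
[cite: Balaban1985Averaging, (78)–(81) p.30, (84)–(88) pp.30–31, (92) p.31; Balaban1985BackgroundPropagators, (3.113) p.418; Balaban1985Variational, (21) p.281] -/
def hierFrameDatumOfRecord : FrameDatum (F.P K) N k U₀ := by
  classical
  exact if hU₀ : SmallBelow (avOfRecord F N K) k U₀ then
    { dom := hierFrameDom (avOfRecord F N K) U₀ k
      dom_mem_nhds := hierFrameDom_mem_nhds F N U₀ hU₀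
      map := fun V y => (framePair (avOfRecord F N K) U₀ V k y).2
      inv := fun V y => (framePair (avOfRecord F N K) U₀ V k y).1
      analyticAt_map := fun V hV => analyticAt_pi_iff.2 fun y => (analyticAt_framePair (avOfRecord F N K) U₀ k hV y).2
      analyticAt_inv := fun V hV => analyticAt_pi_iff.2 fun y => (analyticAt_framePair (avOfRecord F N K) U₀ k hV y).1
      map_mul_inv := fun V _ => funext fun y => framePair_snd_mul_fst (avOfRecord F N K) U₀ V k y
      map_bg := funext fun y => by rw [framePair_coeField_of_smallBelow F N U₀ hU₀ k le_rfl]; rfl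
      deriv := fderiv ℂ (fun (V : PBond (F.P K) 0 → Matrix (Fin N) (Fin N) ℂ) (y : Site (F.P K) k) => (framePair (avOfRecord F N K) U₀ V k y).2)
        (coeField U₀)
      hasFDerivAt_map :=
        ((analyticAt_pi_iff.2 fun y =>
            (analyticAt_framePair (avOfRecord F N K) U₀ k (coeField_mem_hierFrameDom F N U₀ hU₀) y).2).differentiableAt).hasFDerivAt }
  else FrameDatum.frameless k U₀

/-- OFF THE GUARD the datum is the frameless one (the letters `Ū^j(U₀)` of the recursion are junk there; honest vacuity edge).
[cite: Balaban1985Averaging, (92) p.31 (bookkeeping)] -/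
theorem hierFrameDatumOfRecord_of_not_smallBelow (h : ¬ SmallBelow (avOfRecord F N K) k U₀) :
    hierFrameDatumOfRecord F N k U₀ = FrameDatum.frameless k U₀ := by
  rw [hierFrameDatumOfRecord]
  exact dif_neg h

/-- ON THE GUARD: the window is `hierFrameDom`. [cite: Balaban1985Averaging, (81) p.30 (bookkeeping)] -/
theorem hierFrameDatumOfRecord_dom (hU₀ : SmallBelow (avOfRecord F N K) k U₀) :
    (hierFrameDatumOfRecord F N k U₀).dom = hierFrameDom (avOfRecord F N K) U₀ k := by
  rw [hierFrameDatumOfRecord, dif_pos hU₀]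

/-- ON THE GUARD: `map = Ψ_k`. [cite: Balaban1985Averaging, (87) p.31 (bookkeeping)] -/
theorem hierFrameDatumOfRecord_map (hU₀ : SmallBelow (avOfRecord F N K) k U₀) (V : PBond (F.P K) 0 → Matrix (Fin N) (Fin N) ℂ) :
    (hierFrameDatumOfRecord F N k U₀).map V = fun y => (framePair (avOfRecord F N K) U₀ V k y).2 := by
  rw [hierFrameDatumOfRecord, dif_pos hU₀]

/-- ON THE GUARD: `inv = Φ_k`. [cite: Balaban1985Averaging, (86) p.31 (bookkeeping)] -/
theorem hierFrameDatumOfRecord_inv (hU₀ : SmallBelow (avOfRecord F N K) k U₀) (V : PBond (F.P K) 0 → Matrix (Fin N) (Fin N) ℂ) :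
    (hierFrameDatumOfRecord F N k U₀).inv V = fun y => (framePair (avOfRecord F N K) U₀ V k y).1 := by
  rw [hierFrameDatumOfRecord, dif_pos hU₀]

/-- ON THE GUARD: `deriv = fderiv ℂ Ψ_k (↑U₀)`. [cite: Balaban1985BackgroundPropagators, (3.113)–(3.114) p.418 (bookkeeping)] -/
theorem hierFrameDatumOfRecord_deriv (hU₀ : SmallBelow (avOfRecord F N K) k U₀) :
    (hierFrameDatumOfRecord F N k U₀).deriv =
      fderiv ℂ (fun (V : PBond (F.P K) 0 → Matrix (Fin N) (Fin N) ℂ) (y : Site (F.P K) k) => (framePair (avOfRecord F N K) U₀ V k y).2)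
        (coeField U₀) := by
  rw [hierFrameDatumOfRecord, dif_pos hU₀]

/-- ★ WITH THE RECORD'S DATUM, `avPrM` IS THE FRAMED AVERAGE (92): `Ū^{pr}(V)(c) = Ψ_k(V)(c₋) · Ū^k_h(V)(c) · Φ_k(V)(c₊)`.
[cite: Balaban1985Averaging, (80) p.30, (92) p.31] -/
theorem avPrM_hierFrame (hU₀ : SmallBelow (avOfRecord F N K) k U₀) (V : PBond (F.P K) 0 → Matrix (Fin N) (Fin N) ℂ) (c : PBond (F.P K) k) :
    avPrM (hierFrameDatumOfRecord F N k U₀) V c =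
      (framePair (avOfRecord F N K) U₀ V k c.src).2 * iterMh k V c * (framePair (avOfRecord F N K) U₀ V k c.tgt).1 := by
  rw [avPrM_apply, hierFrameDatumOfRecord_map F N k U₀ hU₀, hierFrameDatumOfRecord_inv F N k U₀ hU₀]

/-- The exponents of (85) vanish at the background, at every level `< k`. [cite: Balaban1985Averaging, (78)–(79) p.30 (bookkeeping)] -/
theorem frameExpo_coeField_of_smallBelow {k : ℕ} (hU₀ : SmallBelow (avOfRecord F N K) k U₀) {j : ℕ} (hj : j < k) (y : Site (F.P K) (j + 1)) :
    frameExpo (iterMh j (coeField U₀)) (Averaging.iter (avOfRecord F N K) j U₀) (framePair (avOfRecord F N K) U₀ (coeField U₀) j) y = 0 := by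
  rw [frameExpo]
  simp_rw [frameArg_coeField_of_smallBelow F N U₀ hU₀ hj, mlog_one]
  rw [Finset.sum_const_zero, smul_zero]

omit [NeZero N] in
/-- The block mean of a constant plus a variable term: `L^{-d} Σ_x (K − B_x) = K − Σ_x L^{-d} B_x` (`|B(y)| = L^d`). [cite: Balaban1985Averaging, (79) p.30 (bookkeeping)] -/
theorem invLd_smul_sum_const_sub (Kc : Matrix (Fin N) (Fin N) ℂ) (B : (Fin (F.P K).d → Fin (F.P K).L) → Matrix (Fin N) (Fin N) ℂ) :
    (((F.P K).L : ℂ) ^ (F.P K).d)⁻¹ • ∑ r : Fin (F.P K).d → Fin (F.P K).L, (Kc - B r) =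
      Kc - ∑ r : Fin (F.P K).d → Fin (F.P K).L, (((F.P K).L : ℂ) ^ (F.P K).d)⁻¹ • B r := by
  rw [Finset.sum_sub_distrib, Finset.sum_const, Finset.card_univ, Fintype.card_fun, Fintype.card_fin, Fintype.card_fin, smul_sub,
    Finset.smul_sum]
  congr 1
  rw [← Nat.cast_smul_eq_nsmul ℂ, smul_smul, Nat.cast_pow,
    inv_mul_cancel₀ (pow_ne_zero _ (Nat.cast_ne_zero.2 (F.P K).L_pos.ne')), one_smul]

/-! ## §4. (F1) The germ of the frame along gauge orbits: `DΨ_k(↑U₀)[X_λ] = −(λ∘emb^k − Q′_kλ)` for traceless `λ` -/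

/-- ★★ **THE RECURSION DIFFERENTIATED ALONG A TRACELESS GAUGE ORBIT** `t ↦ (exp tλ) • ↑U₀`: at every level `j ≤ k`,
`d/dt|₀ Φ_j = λ∘emb^j − Q′_jλ` and `d/dt|₀ Ψ_j = −(λ∘emb^j − Q′_jλ)` site-wise — print's p. 418 computation «`R_y(U′_u) = u(y)·exp[−Σ_x L^{-d} log u(x)…]`»
to first order, with `Q′_{j+1} = Q′(Ū^jU₀) ∘ Q′_j` (file 3b's `siteAvgIter_succ`): the logarithm's argument moves with velocity
`(Q′_jλ)(ey) − Ū^jU₀(Γ_{y,x})·(Q′_jλ)(x)·Ū^jU₀(Γ_{y,x})⋆`, whose block mean is `(Q′_jλ)(ey) − (Q′_{j+1}λ)(y)`.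
[cite: Balaban1985BackgroundPropagators, (3.113)–(3.114) p.418, (3.18)–(3.19) p.393; Balaban1985Averaging, (84)–(87) pp.30–31, (11) p.19] -/
theorem hasDerivAt_framePair_slOrbit {k : ℕ} (hU₀ : SmallBelow (avOfRecord F N K) k U₀)
    {lam : Site (F.P K) 0 → Matrix (Fin N) (Fin N) ℂ} (hlam : ∀ x, (lam x).trace = 0) :
    ∀ j, j ≤ k → ∀ y : Site (F.P K) j,
      HasDerivAt (fun t : ℂ => (framePair (avOfRecord F N K) U₀ (slOrbit U₀ lam t) j y).1)
          (lam (embIter j y) - siteAvgIter (avOfRecord F N K) U₀ j lam y) 0 ∧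
        HasDerivAt (fun t : ℂ => (framePair (avOfRecord F N K) U₀ (slOrbit U₀ lam t) j y).2)
          (-(lam (embIter j y) - siteAvgIter (avOfRecord F N K) U₀ j lam y)) 0
  | 0, _, y => by
    simp only [framePair_zero, siteAvgIter_zero, LinearMap.id_apply, embIter, sub_self, neg_zero]
    exact ⟨hasDerivAt_const _ _, hasDerivAt_const _ _⟩
  | j + 1, hj, y => by
    have hjk : j < k := hj
    have ih := hasDerivAt_framePair_slOrbit hU₀ hlam j hjk.le
    set W : GaugeField (F.P K) j (SU N) := Averaging.iter (avOfRecord F N K) j U₀ with hW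
    have hval0 : slOrbit U₀ lam 0 = coeField U₀ := slOrbit_zero U₀ lam
    have hfp0 : ∀ z : Site (F.P K) j, framePair (avOfRecord F N K) U₀ (slOrbit U₀ lam 0) j z = (1, 1) := fun z => by
      rw [hval0, framePair_coeField_of_smallBelow F N U₀ hU₀ j hjk.le]
    have hitbg : iterMh j (coeField U₀) = coeField W := iterMh_coeField_of_smallBelow F N j U₀ (hU₀.mono hjk.le)
    have hg : ∀ r : Fin (F.P K).d → Fin (F.P K).L,
        ctrHolM (iterMh j (slOrbit U₀ lam 0)) y r = ((ctrHol W y r : SU N) : Matrix (Fin N) (Fin N) ℂ) := fun r => by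
      rw [hval0, hitbg, ctrHolM_coeField]
    -- the transporter along the orbit is conjugated by the orbit's end values
    have hZfun : ∀ r : Fin (F.P K).d → Fin (F.P K).L,
        (fun t : ℂ => ctrHolM (iterMh j (slOrbit U₀ lam t)) y r) = fun t : ℂ =>
          exp (t • lam (embIter j (emb y))) * ((ctrHol W y r : SU N) : Matrix (Fin N) (Fin N) ℂ) *
            (exp (t • lam (embIter j (Site.blockSite y r))))⁻¹ := fun r => by
      funext t
      have hfold : holMh (coeField W) (walk (emb y) (ctrWord (F.P K) r)) = ((ctrHol W y r : SU N) : Matrix (Fin N) (Fin N) ℂ) :=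
        ctrHolM_coeField W y r
      rw [iterMh_slOrbit U₀ hlam t j, hitbg, ctrHolM,
        holMh_slGauge_walk (fun z : Site (F.P K) j => exp (t • lam (embIter j z)))
          (fun z => det_exp_smul_eq_one_of_trace_eq_zero (hlam _) t) (coeField W) (emb y) (ctrWord (F.P K) r),
        walkEnd_emb_ctrWord, hfold]
    have hZ' : ∀ r : Fin (F.P K).d → Fin (F.P K).L,
        HasDerivAt (fun t : ℂ => ctrHolM (iterMh j (slOrbit U₀ lam t)) y r)
          (lam (embIter j (emb y)) * ((ctrHol W y r : SU N) : Matrix (Fin N) (Fin N) ℂ) -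
            ((ctrHol W y r : SU N) : Matrix (Fin N) (Fin N) ℂ) * lam (embIter j (Site.blockSite y r))) 0 := fun r => by
      rw [hZfun r]
      exact hasDerivAt_exp_conj_zero _ _ _
    -- the argument of the logarithm
    have hA : ∀ r : Fin (F.P K).d → Fin (F.P K).L,
        HasDerivAt (fun t : ℂ => frameArg (iterMh j (slOrbit U₀ lam t)) W (framePair (avOfRecord F N K) U₀ (slOrbit U₀ lam t) j) y r)
          (siteAvgIter (avOfRecord F N K) U₀ j lam (emb y) -
            ((ctrHol W y r : SU N) : Matrix (Fin N) (Fin N) ℂ) * siteAvgIter (avOfRecord F N K) U₀ j lam (Site.blockSite y r) *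
              star ((ctrHol W y r : SU N) : Matrix (Fin N) (Fin N) ℂ)) 0 := fun r => by
      have h := (((ih (emb y)).2.mul (hZ' r)).mul (ih (Site.blockSite y r)).1).mul_const
        (star ((ctrHol W y r : SU N) : Matrix (Fin N) (Fin N) ℂ))
      simp only [Pi.mul_apply, hfp0, hg] at h
      refine h.congr_deriv ?_
      simp only [one_mul, mul_one, add_mul, sub_mul, mul_sub, neg_mul, mul_assoc, coe_mul_star_coe_SU]
      abel
    -- its logarithm
    have hlog : ∀ r : Fin (F.P K).d → Fin (F.P K).L,
        HasDerivAt (fun t : ℂ => mlog (frameArg (iterMh j (slOrbit U₀ lam t)) W (framePair (avOfRecord F N K) U₀ (slOrbit U₀ lam t) j) y r))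
          (siteAvgIter (avOfRecord F N K) U₀ j lam (emb y) -
            ((ctrHol W y r : SU N) : Matrix (Fin N) (Fin N) ℂ) * siteAvgIter (avOfRecord F N K) U₀ j lam (Site.blockSite y r) *
              star ((ctrHol W y r : SU N) : Matrix (Fin N) (Fin N) ℂ)) 0 := fun r => by
      have h1 : (1 : Matrix (Fin N) (Fin N) ℂ) =
          frameArg (iterMh j (slOrbit U₀ lam 0)) W (framePair (avOfRecord F N K) U₀ (slOrbit U₀ lam 0) j) y r := by
        rw [hval0, frameArg_coeField_of_smallBelow F N U₀ hU₀ hjk]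
      have h := (mlog_hasFDerivAt_one (N := N)).comp_hasDerivAt_of_eq (0 : ℂ) (hA r) h1
      exact h.congr_deriv (by rw [ContinuousLinearMap.coe_id', id_eq])
    -- the exponent
    have hE : HasDerivAt (fun t : ℂ => frameExpo (iterMh j (slOrbit U₀ lam t)) W (framePair (avOfRecord F N K) U₀ (slOrbit U₀ lam t) j) y)
        ((((F.P K).L : ℂ) ^ (F.P K).d)⁻¹ • ∑ r : Fin (F.P K).d → Fin (F.P K).L,
          (siteAvgIter (avOfRecord F N K) U₀ j lam (emb y) -
            ((ctrHol W y r : SU N) : Matrix (Fin N) (Fin N) ℂ) * siteAvgIter (avOfRecord F N K) U₀ j lam (Site.blockSite y r) *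
              star ((ctrHol W y r : SU N) : Matrix (Fin N) (Fin N) ℂ))) 0 := by
      have hsum := HasDerivAt.fun_sum (u := (Finset.univ : Finset (Fin (F.P K).d → Fin (F.P K).L))) fun r _ => hlog r
      have h := hsum.const_smul ((((F.P K).L : ℂ) ^ (F.P K).d)⁻¹)
      have hfun : (fun t : ℂ => frameExpo (iterMh j (slOrbit U₀ lam t)) W (framePair (avOfRecord F N K) U₀ (slOrbit U₀ lam t) j) y) =
          (((F.P K).L : ℂ) ^ (F.P K).d)⁻¹ • fun t : ℂ => ∑ r : Fin (F.P K).d → Fin (F.P K).L,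
            mlog (frameArg (iterMh j (slOrbit U₀ lam t)) W (framePair (avOfRecord F N K) U₀ (slOrbit U₀ lam t) j) y r) := rfl
      rw [hfun]
      exact h
    have hE0 : frameExpo (iterMh j (slOrbit U₀ lam 0)) W (framePair (avOfRecord F N K) U₀ (slOrbit U₀ lam 0) j) y = 0 := by
      rw [hval0]; exact frameExpo_coeField_of_smallBelow F N U₀ hU₀ hjk y
    -- the key block-mean identity: `L^{-d} Σ_x ((Q′_jλ)(ey) − Ad(Ū^jU₀(Γ_{y,x}))(Q′_jλ)(x)) = (Q′_jλ)(ey) − (Q′_{j+1}λ)(y)`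
    have hmean : (((F.P K).L : ℂ) ^ (F.P K).d)⁻¹ • ∑ r : Fin (F.P K).d → Fin (F.P K).L,
          (siteAvgIter (avOfRecord F N K) U₀ j lam (emb y) -
            ((ctrHol W y r : SU N) : Matrix (Fin N) (Fin N) ℂ) * siteAvgIter (avOfRecord F N K) U₀ j lam (Site.blockSite y r) *
              star ((ctrHol W y r : SU N) : Matrix (Fin N) (Fin N) ℂ)) =
        siteAvgIter (avOfRecord F N K) U₀ j lam (emb y) - siteAvgIter (avOfRecord F N K) U₀ (j + 1) lam y := by
      rw [invLd_smul_sum_const_sub, siteAvgIter_succ, LinearMap.comp_apply, siteAvgStep_apply]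
    -- the exponential factors
    have hexp : HasDerivAt (fun t : ℂ => exp (frameExpo (iterMh j (slOrbit U₀ lam t)) W (framePair (avOfRecord F N K) U₀ (slOrbit U₀ lam t) j) y))
        (siteAvgIter (avOfRecord F N K) U₀ j lam (emb y) - siteAvgIter (avOfRecord F N K) U₀ (j + 1) lam y) 0 := by
      have h := (hasFDerivAt_exp_zero (𝕂 := ℂ) (𝔸 := Matrix (Fin N) (Fin N) ℂ)).comp_hasDerivAt_of_eq (0 : ℂ) hE hE0.symm
      exact h.congr_deriv (by rw [← hmean]; rfl)
    have hexpn : HasDerivAt (fun t : ℂ => exp (-frameExpo (iterMh j (slOrbit U₀ lam t)) W (framePair (avOfRecord F N K) U₀ (slOrbit U₀ lam t) j) y))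
        (-(siteAvgIter (avOfRecord F N K) U₀ j lam (emb y) - siteAvgIter (avOfRecord F N K) U₀ (j + 1) lam y)) 0 := by
      have h := (hasFDerivAt_exp_zero (𝕂 := ℂ) (𝔸 := Matrix (Fin N) (Fin N) ℂ)).comp_hasDerivAt_of_eq (0 : ℂ) hE.neg
        (by rw [Pi.neg_apply, hE0, neg_zero])
      exact h.congr_deriv (by rw [← hmean]; rfl)
    refine ⟨?_, ?_⟩
    · show HasDerivAt (fun t : ℂ => (framePair (avOfRecord F N K) U₀ (slOrbit U₀ lam t) j (emb y)).1 *
          exp (frameExpo (iterMh j (slOrbit U₀ lam t)) W (framePair (avOfRecord F N K) U₀ (slOrbit U₀ lam t) j) y)) _ 0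
      have h := (ih (emb y)).1.mul hexp
      simp only [hfp0, hE0, NormedSpace.exp_zero, mul_one, one_mul] at h
      refine h.congr_deriv ?_
      simp only [embIter]
      abel
    · show HasDerivAt (fun t : ℂ => exp (-frameExpo (iterMh j (slOrbit U₀ lam t)) W (framePair (avOfRecord F N K) U₀ (slOrbit U₀ lam t) j) y) *
          (framePair (avOfRecord F N K) U₀ (slOrbit U₀ lam t) j (emb y)).2) _ 0
      have h := hexpn.mul (ih (emb y)).2
      simp only [hfp0, hE0, neg_zero, NormedSpace.exp_zero, mul_one, one_mul] at h
      refine h.congr_deriv ?_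
      simp only [embIter]
      abel

/-- ★ The frame of record differentiated along the traceless gauge orbit: `d/dt|₀ Ψ_k((exp tλ) • ↑U₀) = −(λ∘emb^k − Q′_kλ)`.
[cite: Balaban1985BackgroundPropagators, (3.113)–(3.114) p.418; Balaban1985Averaging, (87) p.31] -/
theorem hierFrame_hasDerivAt_map_slOrbit (hU₀ : SmallBelow (avOfRecord F N K) k U₀)
    {lam : Site (F.P K) 0 → Matrix (Fin N) (Fin N) ℂ} (hlam : ∀ x, (lam x).trace = 0) :
    HasDerivAt (fun t : ℂ => (hierFrameDatumOfRecord F N k U₀).map (slOrbit U₀ lam t))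
      (fun y => -(lam (embIter k y) - siteAvgIter (avOfRecord F N K) U₀ k lam y)) 0 := by
  simp only [hierFrameDatumOfRecord_map F N k U₀ hU₀]
  exact hasDerivAt_pi.2 fun y => (hasDerivAt_framePair_slOrbit F N U₀ hU₀ hlam k le_rfl y).2

omit [NeZero N] in
/-- The left-velocity letter of the chart direction `D_{U₀}λ` is minus the velocity of the gauge orbit: `(U₀λ(b₊)U₀⋆ − λ(b₋))·U₀ = −(λ(b₋)U₀ − U₀λ(b₊))`.
[cite: Balaban1985BackgroundPropagators, (3.1)–(3.3) pp.390–391; Balaban1985Variational, (19) p.281 (bookkeeping)] -/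
theorem leftVelC_covGrad (lam : Site (F.P K) 0 → Matrix (Fin N) (Fin N) ℂ) :
    leftVelC U₀ (fun b : PBond (F.P K) 0 => (U₀ b : Matrix (Fin N) (Fin N) ℂ) * lam b.tgt * star (U₀ b : Matrix (Fin N) (Fin N) ℂ) - lam b.src) =
      -fun b : PBond (F.P K) 0 => lam b.src * (U₀ b : Matrix (Fin N) (Fin N) ℂ) - (U₀ b : Matrix (Fin N) (Fin N) ℂ) * lam b.tgt := by
  funext b
  rw [leftVelC_apply, Pi.neg_apply, sub_mul, mul_assoc, mul_assoc, star_coe_mul_coe_SU, mul_one, neg_sub]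

/-- ★★★ **(F1) THE GERM OF THE RECORD'S FRAME ALONG GAUGE ORBITS — CENTRE VALUE MINUS PRINT'S BLOCK MEAN**: under the record's guard below `k`, for every
TRACELESS `λ : sites → 𝔰𝔩_N(ℂ)`, the derivative letter of `hierFrameDatumOfRecord` maps the chart direction `leftVelC U₀ (D_{U₀}λ)`,
`(D_{U₀}λ)(b) = U₀(b)λ(b₊)U₀(b)⋆ − λ(b₋)`, to `λ∘emb^k − Q′_kλ` (`Q′_k = siteAvgIter`, (3.19)).  (Chain rule along `t ↦ (exp tλ) • ↑U₀` through
`hasFDerivAt_map`, uniqueness of the derivative, and §4's recursion.)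
[cite: Balaban1985BackgroundPropagators, (3.113)–(3.114) p.418, (3.18)–(3.19) p.393; Balaban1985Averaging, (84)–(87) pp.30–31] -/
theorem hierFrame_deriv_gauge (hU₀ : SmallBelow (avOfRecord F N K) k U₀)
    {lam : Site (F.P K) 0 → Matrix (Fin N) (Fin N) ℂ} (hlam : ∀ x, (lam x).trace = 0) :
    (hierFrameDatumOfRecord F N k U₀).deriv
        (leftVelC U₀ fun b : PBond (F.P K) 0 => (U₀ b : Matrix (Fin N) (Fin N) ℂ) * lam b.tgt * star (U₀ b : Matrix (Fin N) (Fin N) ℂ) - lam b.src) =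
      fun y => lam (embIter k y) - siteAvgIter (avOfRecord F N K) U₀ k lam y := by
  have hF := (hierFrameDatumOfRecord F N k U₀).hasFDerivAt_map
  have hcomp : HasDerivAt (fun t : ℂ => (hierFrameDatumOfRecord F N k U₀).map (slOrbit U₀ lam t))
      ((hierFrameDatumOfRecord F N k U₀).deriv
        fun b : PBond (F.P K) 0 => lam b.src * (U₀ b : Matrix (Fin N) (Fin N) ℂ) - (U₀ b : Matrix (Fin N) (Fin N) ℂ) * lam b.tgt) 0 :=
    hF.comp_hasDerivAt_of_eq (0 : ℂ) (hasDerivAt_slOrbit_zero U₀ lam) (slOrbit_zero U₀ lam).symm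
  have huniq := hcomp.unique (hierFrame_hasDerivAt_map_slOrbit F N k U₀ hU₀ hlam)
  rw [leftVelC_covGrad, map_neg, huniq]
  funext y
  rw [Pi.neg_apply, neg_neg]

/-! ## §5. (3.114): `Q^{pr}_k(U₀)(D_{U₀}λ) = L^{-k}·D_{Ū₀}(Q′_kλ)` on `𝔰𝔩_N`-valued `λ` -/

end Record

section CovGrad

variable {P : Params} {N : ℕ}

/-- The skew part of the skew part's conjugate transpose: `(𝔞Y)(b)ᴴ = −(𝔞Y)(b)`. [cite: Balaban1985BackgroundPropagators, p.393 (bookkeeping)] -/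
theorem star_skewField {ι : Type*} (Y : ι → Matrix (Fin N) (Fin N) ℂ) (b : ι) : star (skewField Y b) = -skewField Y b := by
  rw [skewField_apply, Matrix.star_eq_conjTranspose, Matrix.conjTranspose_smul, Matrix.conjTranspose_sub, Matrix.conjTranspose_conjTranspose,
    ← smul_neg, neg_sub]
  congr 1
  simp

/-- The skew part of a traceless field is traceless. [cite: Balaban1985BackgroundPropagators, p.393 (bookkeeping)] -/
theorem trace_skewField_eq_zero {ι : Type*} {Y : ι → Matrix (Fin N) (Fin N) ℂ} (hY : ∀ b, (Y b).trace = 0) (b : ι) : (skewField Y b).trace = 0 := by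
  rw [skewField_apply, Matrix.trace_smul, Matrix.trace_sub, Matrix.trace_conjTranspose, hY b, star_zero, sub_zero, smul_zero]

/-- The skew part commutes with the background-covariant differential: `𝔞(U₀λ(b₊)U₀⋆ − λ(b₋)) = U₀(𝔞λ)(b₊)U₀⋆ − (𝔞λ)(b₋)` (n07-w3's Summits-side
`skewField_covGradM`, Literature edition). [cite: Balaban1985BackgroundPropagators, (3.3) p.391, p.393 (bookkeeping)] -/
theorem skewField_covGrad (U₀ : GaugeField P 0 (SU N)) (lam : Site P 0 → Matrix (Fin N) (Fin N) ℂ) :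
    skewField (fun b : PBond P 0 => (U₀ b : Matrix (Fin N) (Fin N) ℂ) * lam b.tgt * star (U₀ b : Matrix (Fin N) (Fin N) ℂ) - lam b.src) =
      fun b : PBond P 0 => (U₀ b : Matrix (Fin N) (Fin N) ℂ) * skewField lam b.tgt * star (U₀ b : Matrix (Fin N) (Fin N) ℂ) - skewField lam b.src := by
  funext b
  simp only [skewField_apply, Matrix.conjTranspose_sub, Matrix.conjTranspose_mul, Matrix.conjTranspose_conjTranspose, Matrix.star_eq_conjTranspose,
    smul_sub, mul_sub, sub_mul, mul_smul_comm, smul_mul_assoc, mul_assoc]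
  abel

/-- The same for the rotated field `−iλ`. [cite: Balaban1985BackgroundPropagators, p.393 (bookkeeping)] -/
theorem skewField_negI_covGrad (U₀ : GaugeField P 0 (SU N)) (lam : Site P 0 → Matrix (Fin N) (Fin N) ℂ) :
    skewField (-Complex.I • fun b : PBond P 0 => (U₀ b : Matrix (Fin N) (Fin N) ℂ) * lam b.tgt * star (U₀ b : Matrix (Fin N) (Fin N) ℂ) - lam b.src) =
      fun b : PBond P 0 => (U₀ b : Matrix (Fin N) (Fin N) ℂ) * skewField (-Complex.I • lam) b.tgt * star (U₀ b : Matrix (Fin N) (Fin N) ℂ) -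
        skewField (-Complex.I • lam) b.src := by
  have h : (-Complex.I • fun b : PBond P 0 => (U₀ b : Matrix (Fin N) (Fin N) ℂ) * lam b.tgt * star (U₀ b : Matrix (Fin N) (Fin N) ℂ) - lam b.src) =
      fun b : PBond P 0 => (U₀ b : Matrix (Fin N) (Fin N) ℂ) * (-Complex.I • lam) b.tgt * star (U₀ b : Matrix (Fin N) (Fin N) ℂ) -
        (-Complex.I • lam) b.src := by
    funext b
    simp only [Pi.smul_apply, smul_sub, mul_smul_comm, smul_mul_assoc]
  rw [h]
  exact skewField_covGrad U₀ (-Complex.I • lam)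

variable [NeZero N]

/-- ★ **THE REAL-FORM LETTER ON THE COVARIANT DIFFERENTIAL OF AN `𝔰𝔲(N)`-VALUED FIELD**: under 35b's guard below `k`, for `χ : sites → 𝔰𝔲(N)`,
`qSkewOp k U₀ (b ↦ U₀(b)χ(b₊)U₀(b)⋆ − χ(b₋)) c = L^{-k} • (Ū^k(U₀)(c)·χ(emb^k c₊)·Ū^k(U₀)(c)⋆ − χ(emb^k c₋))`
(n07-w1's ✓`dIterL_apply_infGauge`, right-trivialised).
[cite: Balaban1985BackgroundPropagators, (3.13)–(3.15) p.393, (3.3) p.391; Balaban1985Variational, (44) p.285; Balaban1985Averaging, (11) p.19] -/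
theorem qSkewOp_covGrad_of_lieSU {U₀ : GaugeField P 0 (SU N)} {k : ℕ} (h : SmallBelow (fun j => blockAvg (P := P) (j := j) expMeanLogSU) k U₀)
    {χ : Site P 0 → Matrix (Fin N) (Fin N) ℂ} (hχ : ∀ x, star (χ x) = -χ x) (htr : ∀ x, (χ x).trace = 0) (c : PBond P k) :
    qSkewOp k U₀ (fun b : PBond P 0 => (U₀ b : Matrix (Fin N) (Fin N) ℂ) * χ b.tgt * star (U₀ b : Matrix (Fin N) (Fin N) ℂ) - χ b.src) c =
      ((P.L : ℂ) ^ k)⁻¹ • (((Averaging.iter (fun j => blockAvg (P := P) (j := j) expMeanLogSU) k U₀ c : SU N) : Matrix (Fin N) (Fin N) ℂ) *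
            χ (embIter k c.tgt) * star ((Averaging.iter (fun j => blockAvg (P := P) (j := j) expMeanLogSU) k U₀ c : SU N) : Matrix (Fin N) (Fin N) ℂ) -
          χ (embIter k c.src)) := by
  set L : Site P 0 → lieSU (Fin N) := fun x => ⟨χ x, mem_lieSU_iff.2 ⟨hχ x, htr x⟩⟩ with hL
  have hLx : ∀ x, (L x : Matrix (Fin N) (Fin N) ℂ) = χ x := fun x => rfl
  have hdir : (fun b : PBond P 0 => ((U₀ b : Matrix (Fin N) (Fin N) ℂ) * χ b.tgt * star (U₀ b : Matrix (Fin N) (Fin N) ℂ) - χ b.src) *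
        (U₀ b : Matrix (Fin N) (Fin N) ℂ)) =
      -fun b : PBond P 0 => (L b.src : Matrix (Fin N) (Fin N) ℂ) * (U₀ b : Matrix (Fin N) (Fin N) ℂ) -
        (U₀ b : Matrix (Fin N) (Fin N) ℂ) * (L b.tgt : Matrix (Fin N) (Fin N) ℂ) := by
    funext b
    rw [Pi.neg_apply, hLx, hLx, sub_mul, mul_assoc, mul_assoc, star_coe_mul_coe_SU, mul_one, neg_sub]
  rw [qSkewOp_apply, hdir, map_neg, Pi.neg_apply, dIterL_apply_infGauge h L c, ← coeField_iter_eq_iterM k h, coeField_apply, hLx, hLx]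
  congr 1
  set V : Matrix (Fin N) (Fin N) ℂ := ((Averaging.iter (fun j => blockAvg (P := P) (j := j) expMeanLogSU) k U₀ c : SU N) : Matrix (Fin N) (Fin N) ℂ)
  have hV : V * star V = 1 := coe_mul_star_coe_SU _
  rw [neg_mul, sub_mul, mul_assoc (χ (embIter k c.src)), hV, mul_one, neg_sub]

/-- ★★ **THE UN-FRAMED IDENTITY `q^{ff}_k(U₀)(D_{U₀}λ) = L^{-k}·D_{Ū₀}(λ∘emb^k)` ON `𝔰𝔩_N`-VALUED `λ`**: under 35b's guard below `k`, for traceless `λ`,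
`qCplxOp k U₀ (b ↦ U₀λ(b₊)U₀⋆ − λ(b₋)) c = L^{-k} • (Ū(c)λ(emb^k c₊)Ū(c)⋆ − λ(emb^k c₋))` — the two `𝔰𝔲(N)`-parts by `qSkewOp_covGrad_of_lieSU`, recombined by
file 3b's `skewField_decomp` (the Literature edition, on `𝔤ᶜ = 𝔰𝔩_N`, of n07-w3's Summits-side `qCplxOp_covGradM`).
[cite: Balaban1985BackgroundPropagators, (3.13)–(3.16) p.393; Balaban1985Variational, (44) p.285; Balaban1985Averaging, (11) p.19] -/
theorem qCplxOp_covGrad_of_trace_zero {U₀ : GaugeField P 0 (SU N)} {k : ℕ} (h : SmallBelow (fun j => blockAvg (P := P) (j := j) expMeanLogSU) k U₀)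
    {lam : Site P 0 → Matrix (Fin N) (Fin N) ℂ} (hlam : ∀ x, (lam x).trace = 0) (c : PBond P k) :
    qCplxOp k U₀ (fun b : PBond P 0 => (U₀ b : Matrix (Fin N) (Fin N) ℂ) * lam b.tgt * star (U₀ b : Matrix (Fin N) (Fin N) ℂ) - lam b.src) c =
      ((P.L : ℂ) ^ k)⁻¹ • (((Averaging.iter (fun j => blockAvg (P := P) (j := j) expMeanLogSU) k U₀ c : SU N) : Matrix (Fin N) (Fin N) ℂ) *
            lam (embIter k c.tgt) * star ((Averaging.iter (fun j => blockAvg (P := P) (j := j) expMeanLogSU) k U₀ c : SU N) : Matrix (Fin N) (Fin N) ℂ) -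
          lam (embIter k c.src)) := by
  have hs1 : ∀ x, star (skewField lam x) = -skewField lam x := star_skewField lam
  have ht1 : ∀ x, (skewField lam x).trace = 0 := trace_skewField_eq_zero hlam
  have hs2 : ∀ x, star (skewField (-Complex.I • lam) x) = -skewField (-Complex.I • lam) x := star_skewField (-Complex.I • lam)
  have ht2 : ∀ x, (skewField (-Complex.I • lam) x).trace = 0 :=
    trace_skewField_eq_zero fun x => by rw [Pi.smul_apply, Matrix.trace_smul, hlam x, smul_zero]
  unfold qCplxOp
  rw [cplxOp_apply, skewField_covGrad, skewField_negI_covGrad, Pi.add_apply, Pi.smul_apply, qSkewOp_covGrad_of_lieSU h hs1 ht1 c,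
    qSkewOp_covGrad_of_lieSU h hs2 ht2 c]
  have ht := congrFun (skewField_decomp lam) (embIter k c.tgt)
  have hsrc := congrFun (skewField_decomp lam) (embIter k c.src)
  simp only [Pi.add_apply, Pi.smul_apply] at ht hsrc
  rw [← ht, ← hsrc]
  simp only [smul_sub, mul_add, add_mul, mul_smul_comm, smul_mul_assoc, smul_add]
  module

end CovGrad

section Record

variable (F : T4Family) (N : ℕ) [NeZero N] {K : ℕ} (k : ℕ) (U₀ : GaugeField (F.P K) 0 (SU N))

/-- ★ **(3.114) AS A DISPLAYED TOKEN ON `𝔤ᶜ = 𝔰𝔩_N(ℂ)`-VALUED `λ`** — file A2's `FrameIntertwinesTok` restricted to TRACELESS site fields (print's Lie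
algebra; the tree's carriers carry an extra scalar direction on which the adjugate-continued letters are not covariant — see the module docstring).
[cite: Balaban1985BackgroundPropagators, (3.114)–(3.115) p.418, (3.18)–(3.19) p.393] -/
def FrameIntertwinesTokSL (𝔥 : FrameDatum (F.P K) N k U₀) : Prop :=
  ∀ (lam : Site (F.P K) 0 → Matrix (Fin N) (Fin N) ℂ), (∀ x, (lam x).trace = 0) → ∀ (c : PBond (F.P K) k),
    qPrCplxOp k U₀ 𝔥 (fun b : PBond (F.P K) 0 => (U₀ b : Matrix (Fin N) (Fin N) ℂ) * lam b.tgt * star (U₀ b : Matrix (Fin N) (Fin N) ℂ) - lam b.src) c =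
      (((F.P K).L : ℂ) ^ k)⁻¹ •
        (((Averaging.iter (avOfRecord F N K) k U₀ c : SU N) : Matrix (Fin N) (Fin N) ℂ) * siteAvgIter (avOfRecord F N K) U₀ k lam c.tgt *
            star ((Averaging.iter (avOfRecord F N K) k U₀ c : SU N) : Matrix (Fin N) (Fin N) ℂ) -
          siteAvgIter (avOfRecord F N K) U₀ k lam c.src)

/-- The all-matrix token implies the `𝔰𝔩_N` one. [cite: Balaban1985BackgroundPropagators, (3.114) p.418 (bookkeeping)] -/
theorem frameIntertwinesTokSL_of_tok (𝔥 : FrameDatum (F.P K) N k U₀) (h : FrameIntertwinesTok F N k U₀ 𝔥) : FrameIntertwinesTokSL F N k U₀ 𝔥 :=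
  fun lam _ c => h lam c

/-- The un-framed identity at the record: `qCplxOp k U₀ (D_{U₀}λ)(c) = L^{-k}·(Ū^k(U₀)(c)·λ(emb^k c₊)·Ū^k(U₀)(c)⋆ − λ(emb^k c₋))` for traceless `λ`.
[cite: Balaban1985BackgroundPropagators, (3.13)–(3.16) p.393; Balaban1985Averaging, (11) p.19] -/
theorem qCplxOp_covGrad_of_trace_zero_record (hU₀ : SmallBelow (avOfRecord F N K) k U₀)
    {lam : Site (F.P K) 0 → Matrix (Fin N) (Fin N) ℂ} (hlam : ∀ x, (lam x).trace = 0) (c : PBond (F.P K) k) :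
    qCplxOp k U₀ (fun b : PBond (F.P K) 0 => (U₀ b : Matrix (Fin N) (Fin N) ℂ) * lam b.tgt * star (U₀ b : Matrix (Fin N) (Fin N) ℂ) - lam b.src) c =
      (((F.P K).L : ℂ) ^ k)⁻¹ •
        (((Averaging.iter (avOfRecord F N K) k U₀ c : SU N) : Matrix (Fin N) (Fin N) ℂ) * lam (embIter k c.tgt) *
            star ((Averaging.iter (avOfRecord F N K) k U₀ c : SU N) : Matrix (Fin N) (Fin N) ℂ) -
          lam (embIter k c.src)) :=
  qCplxOp_covGrad_of_trace_zero hU₀ hlam c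

/-- ★★★ **(3.114) FOR THE RECORD'S FRAME: `Q^{pr}_k(U₀)(D_{U₀}λ)(c) = L^{-k}·(Ū₀(c)·(Q′_kλ)(c₊)·Ū₀(c)⋆ − (Q′_kλ)(c₋))`** for every traceless `λ`, under the
record's guard below `k` — «`(Q̄ D_{U₀}λ)(c) = (Q′λ)(c₊) − (Q′λ)(c₋) = (D_{Ū₀}Q′λ)(c)`», iterated ((3.115)): the un-framed `q^{ff}` carries `D_{U₀}λ` to
`L^{-k}·D_{Ū₀}(λ∘emb^k)` (`qCplxOp_covGrad_of_trace_zero`), and the frame correction `−frameCorr (Dh X)` with (F1) `Dh X = λ∘emb^k − Q′_kλ` replaces the centre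
values by the block means. [cite: Balaban1985BackgroundPropagators, (3.113)–(3.115) p.418, (3.18)–(3.19) p.393, (3.13) p.393; Balaban1985Averaging, (89) p.31, (92) p.31] -/
theorem frameIntertwinesTokSL_hierFrame (hU₀ : SmallBelow (avOfRecord F N K) k U₀) :
    FrameIntertwinesTokSL F N k U₀ (hierFrameDatumOfRecord F N k U₀) := by
  intro lam hlam c
  have hit : iterM k (coeField U₀) = coeField (Averaging.iter (avOfRecord F N K) k U₀) := (coeField_iter_eq_iterM k hU₀).symm
  rw [qPrCplxOp_apply, Pi.sub_apply, hierFrame_deriv_gauge F N k U₀ hU₀ hlam, frameCorr_apply, qCplxOp_covGrad_of_trace_zero_record F N k U₀ hU₀ hlam c,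
    hit, coeField_apply, ← smul_sub]
  congr 1
  simp only [mul_sub, sub_mul]
  abel

end Record

end Literature.MathematicalPhysics.QuantumFieldTheory.Balaban1983to89.Node00

end
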